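import Summits.AnomalousDissipation.AnomalousDissipation.Theses.DecoupledCatalysts

/-!
# Glue of the split of `DecoupledCatalysts.DesignerExtension`

Sorry-free proof of the GLUE item `DecoupledCatalysts.DesignerExtensionGlue` (stmt-AnomalousDissipation-31802):
`CatalystSmoothing → SmoothCatalystExtension → DesignerExtension` — composition of the two implications.  No facts are asserted.
Source: decomp-ad cell node «DecoupledCatalysts» (`splitGlue_holds : fun h₁ h₂ hA => h₂ (h₁ hA)`, writer SketchCR
`designerExtensionGlueW_holds`); landed by the cell's prover seat.
-/

set_option linter.dupNamespace false

namespace Summit.AnomalousDissipation.AnomalousDissipation.Theorems.DesignerExtensionGlue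

open Summit.AnomalousDissipation.AnomalousDissipation.Theses.DecoupledCatalysts

/-- The GLUE item `DecoupledCatalysts.DesignerExtensionGlue` (stmt-AnomalousDissipation-31802) holds: composition. [folklore] -/
theorem designerExtensionGlue_holds : DesignerExtensionGlue :=
  fun h₁ h₂ hA => h₂ (h₁ hA)

end Summit.AnomalousDissipation.AnomalousDissipation.Theorems.DesignerExtensionGlue
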